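import Mathlib.AlgebraicGeometry.AffineTransitionLimit
import Mathlib.AlgebraicGeometry.Noetherian
import Mathlib.RingTheory.Adjoin.FG
import Mathlib.RingTheory.FiniteType
import Literature.AlgebraicGeometry.Motives.Varieties
import HarnessLib

/-!
# Limits of schemes: `P ×_K Spec B` as the limit of the `P ×_K Spec B₀`, `B₀ ⊆ B` of finite type

Topic: `Literature/AlgebraicGeometry/Limits` (Görtz–Wedhorn I, (10.13) 1.: "Let `R` be a ring.
Then `R` is the filtered union of its finitely generated `ℤ`-subalgebras `R_λ` [...] `Spec R` is
the filtered projective limit of the `Spec R_λ`"; EGA IV₃ §8.2). The companion file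
`Limits/FieldExtensionDiagram` treats a field extension `k ⊆ K` and the base changes
`Spec k(t) ×_{k'} Y`; here `K` is any commutative ring, `B` a commutative `K`-algebra, and for a
`K`-scheme `P` (an object of `Over (Spec K)`, with the cartesian monoidal structure
`P ⊗ T = P ×_K T` of Mathlib) we present `P ×_K Spec B = (P ⊗ Spec B).left` as the limit of the
cofiltered diagram `t ↦ (P ⊗ Spec K[t]).left` over the finite subsets `t ⊇ s₁` of `B`, where
`K[t] ⊆ B` is the (finitely generated) `K`-subalgebra generated by `t` — the setting of Mathlib's
`Mathlib.AlgebraicGeometry.AffineTransitionLimit` (Stacks 01YT), used for noetherian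
approximation of Cartier divisors on `P ×_K T`, `T` an affine `K`-scheme
(`Motives/CartierDivisorLimitDescent`).

## Content (`namespace SubalgApprox`)

* `Idx B s₁ = {t : Finset B // s₁ ⊆ t}` (directed), `sub K B t = K[t]`, `ringDiagram`,
  `ringCocone`, `isColimitRingCocone` — `B = colim_t K[t]` in `CommRingCat`.
* `baseDiagram`, `baseCone`, `isLimitBaseCone` — `Spec B = lim_t Spec K[t]` in `Over (Spec K)`.
* `prodDiagram P = baseDiagram ⋙ tensorLeft P ⋙ Over.forget`, `prodCone P`,
  **`isLimitProdCone P`** — `(P ⊗ Spec B).left = lim_t (P ⊗ Spec K[t]).left` in `Scheme`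
  (proved directly from the universal property of the fibre product), with the `rfl`-API
  (`prodDiagram_obj/map`, `prodCone_pt/π_app`), the base-change squares
  `isPullback_whiskerLeft_left` (for any `K`-morphism `T' → T`, `(P ⊗ T').left → (P ⊗ T).left`
  is the base change of `T'.left → T.left`), affineness of legs and transition maps,
  quasi-compactness / quasi-separatedness of the objects, `exists_hom_of_finite` (common
  refinement of finitely many stages), and, for `B` a domain and `K` a field, integrality and
  local noetherianity of the stages `Spec K[t]` and dominance of `Spec B → Spec K[t]`.

Mathlib searched (pin): `AffineTransitionLimit` (consumer API), `Over.whiskerLeft_left_fst/snd`,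
`Over.tensorObj_left`, `IsPullback.of_right`, `MorphismProperty.of_isPullback`,
`Types.FilteredColimit.isColimitOf`, `Scheme.Spec` preserves limits (used);
`Literature.AlgebraicGeometry.Limits.FieldExt` (same construction for fields, model of this file).

## References

* U. Görtz, T. Wedhorn, *Algebraic Geometry I: Schemes*, 2nd ed. (2020), (10.13) and
  Thm. 10.57–10.66, pp. 321–327. [GortzWedhorn2020]
* A. Grothendieck, EGA IV₃, §8.2 (Publ. Math. IHÉS 28, 1966). [EGAIV3]
-/

noncomputable section

universe u

open CategoryTheory CategoryTheory.Limits AlgebraicGeometry TopologicalSpace MonoidalCategory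
open Opposite

namespace Literature.AlgebraicGeometry.Limits

namespace SubalgApprox

open Literature.AlgebraicGeometry.Motives (SchemeOver specOver)

set_option backward.isDefEq.respectTransparency false

variable (K B : Type u) [CommRing K] [CommRing B] [Algebra K B] (s₁ : Finset B)

/-! ## The index type and the diagram of finitely generated subalgebras -/

/-- The index type: finite subsets of `B` containing `s₁`, ordered by inclusion (a directed,
nonempty preorder, hence a filtered category). [folklore] -/
abbrev Idx : Type u := {t : Finset B // s₁ ⊆ t}

/-- `s₁` itself is an index. [folklore] -/
instance : Nonempty (Idx B s₁) := ⟨⟨s₁, subset_rfl⟩⟩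

/-- `s₁` itself is the default index. [folklore] -/
instance : Inhabited (Idx B s₁) := ⟨⟨s₁, subset_rfl⟩⟩

/-- The index type is directed (take unions). [folklore] -/
instance : IsDirected (Idx B s₁) (· ≤ ·) := by
  classical
  refine ⟨fun a b => ⟨⟨a.1 ∪ b.1, a.2.trans Finset.subset_union_left⟩, ?_, ?_⟩⟩
  · exact Finset.subset_union_left
  · exact Finset.subset_union_right

/-- The `K`-subalgebra `K[t]` of `B` generated by a finite subset `t ⊆ B`. [folklore] -/
abbrev sub (t : Finset B) : Subalgebra K B := Algebra.adjoin K (t : Set B)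

variable {K B} in
/-- `t ⊆ t'` gives `K[t] ≤ K[t']`. [folklore] -/
theorem sub_mono {t t' : Finset B} (h : t ⊆ t') : sub K B t ≤ sub K B t' :=
  Algebra.adjoin_mono (by exact_mod_cast h)

/-- `K[t]` is a finitely generated `K`-algebra. [folklore] -/
theorem fg_sub (t : Finset B) : (sub K B t).FG := ⟨t, rfl⟩

/-- `K[t]` is of finite type over `K`. [folklore] -/
instance finiteType_sub (t : Finset B) : Algebra.FiniteType K (sub K B t) :=
  ⟨(Subalgebra.fg_top _).mpr (fg_sub K B t)⟩

/-- Every element of `B` lies in some `K[t]`, `t ⊇ s₁`. [folklore] -/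
theorem exists_mem_sub (b : B) : ∃ t : Idx B s₁, b ∈ sub K B t.1 := by
  classical
  exact ⟨⟨s₁ ∪ {b}, Finset.subset_union_left⟩, Algebra.subset_adjoin (by simp)⟩

/-- The filtered diagram `t ↦ K[t]` of finitely generated subalgebras.
[cite: GortzWedhorn2020, (10.13) 1., p. 321] -/
def ringDiagram : Idx B s₁ ⥤ CommRingCat.{u} where
  obj t := CommRingCat.of (sub K B t.1)
  map {t t'} f := CommRingCat.ofHom (Subalgebra.inclusion (sub_mono f.le)).toRingHom
  map_id t := by ext x; rfl
  map_comp f g := by ext x; rfl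

/-- The cocone of inclusions `K[t] ⊆ B`. [folklore] -/
def ringCocone : Cocone (ringDiagram K B s₁) where
  pt := CommRingCat.of B
  ι := { app t := CommRingCat.ofHom (sub K B t.1).val.toRingHom
         naturality t t' f := by ext x; rfl }

/-- `B` is the directed union of the `K[t]`, `t ⊇ s₁` finite.
[cite: GortzWedhorn2020, (10.13) 1., p. 321] -/
def isColimitRingCocone : IsColimit (ringCocone K B s₁) := by
  haveI : ReflectsColimit (ringDiagram K B s₁) (forget CommRingCat.{u}) :=
    reflectsColimit_of_reflectsIsomorphisms _ _
  refine isColimitOfReflects (forget CommRingCat.{u}) ?_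
  classical
  refine Types.FilteredColimit.isColimitOf _ _ (fun x ↦ ?_) (fun t t' x y h ↦ ?_)
  · change B at x
    refine ⟨⟨s₁ ∪ {x}, Finset.subset_union_left⟩, ⟨x, Algebra.subset_adjoin ?_⟩, rfl⟩
    simp
  · refine ⟨⟨t.1 ∪ t'.1, t.2.trans Finset.subset_union_left⟩, homOfLE Finset.subset_union_left,
      homOfLE Finset.subset_union_right, ?_⟩
    apply Subtype.ext
    exact h

/-- The structure maps `K → K[t]`. [folklore] -/
def baseNat : (Functor.const (Idx B s₁)).obj (CommRingCat.of K) ⟶ ringDiagram K B s₁ where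
  app t := CommRingCat.ofHom (algebraMap K (sub K B t.1))
  naturality t t' f := by ext x; rfl

/-- The structure maps `K → K[t] ⊆ B` compose to `K → B`. [folklore] -/
theorem baseNat_ι (t : Idx B s₁) :
    (baseNat K B s₁).app t ≫ (ringCocone K B s₁).ι.app t = CommRingCat.ofHom (algebraMap K B) := by
  ext x; rfl

/-! ## `Spec B = lim Spec K[t]` over `Spec K` -/

/-- The cofiltered diagram of `K`-schemes `Spec K[t]`. [folklore] -/
def baseDiagram : (Idx B s₁)ᵒᵖ ⥤ SchemeOver K where
  obj t := specOver K (sub K B t.unop.1)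
  map {t t'} f := Over.homMk (Spec.map ((ringDiagram K B s₁).map f.unop)) (by
    change Spec.map _ ≫ Spec.map ((baseNat K B s₁).app t'.unop) =
      Spec.map ((baseNat K B s₁).app t.unop)
    rw [← Spec.map_comp]
    congr 1)
  map_id t := by
    ext : 1
    change Spec.map ((ringDiagram K B s₁).map (𝟙 t.unop)) = 𝟙 _
    rw [(ringDiagram K B s₁).map_id, Spec.map_id]
  map_comp f g := by
    ext : 1
    change Spec.map ((ringDiagram K B s₁).map (g.unop ≫ f.unop)) = Spec.map _ ≫ Spec.map _
    rw [(ringDiagram K B s₁).map_comp, Spec.map_comp]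

/-- The cone `Spec B → Spec K[t]` of `K`-schemes. [folklore] -/
def baseCone : Cone (baseDiagram K B s₁) where
  pt := specOver K B
  π := { app t := Over.homMk (Spec.map ((ringCocone K B s₁).ι.app t.unop)) (by
            change Spec.map _ ≫ Spec.map ((baseNat K B s₁).app t.unop) =
              Spec.map (CommRingCat.ofHom (algebraMap K B))
            rw [← Spec.map_comp, baseNat_ι])
         naturality t t' f := by
            ext : 1
            change 𝟙 _ ≫ Spec.map _ = Spec.map _ ≫ Spec.map _
            rw [Category.id_comp, ← Spec.map_comp]
            exact congrArg Spec.map ((ringCocone K B s₁).w f.unop).symm }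

/-- The objects of `baseDiagram` (by `rfl`). [folklore] -/
theorem baseDiagram_obj (t : (Idx B s₁)ᵒᵖ) :
    (baseDiagram K B s₁).obj t = specOver K (sub K B t.unop.1) := rfl

/-- The transition maps of `baseDiagram` (by `rfl`). [folklore] -/
theorem baseDiagram_map_left {t t' : (Idx B s₁)ᵒᵖ} (f : t ⟶ t') :
    ((baseDiagram K B s₁).map f).left = Spec.map ((ringDiagram K B s₁).map f.unop) := rfl

/-- The cone point of `baseCone` (by `rfl`). [folklore] -/
theorem baseCone_pt : (baseCone K B s₁).pt = specOver K B := rfl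

/-- The legs of `baseCone` (by `rfl`). [folklore] -/
theorem baseCone_π_app_left (t : (Idx B s₁)ᵒᵖ) :
    ((baseCone K B s₁).π.app t).left = Spec.map ((ringCocone K B s₁).ι.app t.unop) := rfl

/-- `Over.forget` maps `baseCone` to `Spec` of the ring cocone (by `rfl`). [folklore] -/
theorem forget_mapCone_baseCone :
    (Over.forget _).mapCone (baseCone K B s₁) = Scheme.Spec.mapCone (ringCocone K B s₁).op := rfl

/-- `Spec B` is the limit of the `Spec K[t]` in `Scheme`. [folklore] -/
def isLimitForgetBaseCone : IsLimit ((Over.forget _).mapCone (baseCone K B s₁)) := by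
  rw [forget_mapCone_baseCone]
  exact isLimitOfPreserves Scheme.Spec (isColimitRingCocone K B s₁).op

/-- `Spec B` is the limit of the `Spec K[t]` in `K`-schemes.
[cite: GortzWedhorn2020, (10.13) 1., p. 321] -/
def isLimitBaseCone : IsLimit (baseCone K B s₁) := by
  haveI : IsConnected (Idx B s₁) := IsFiltered.isConnected _
  exact isLimitOfReflects (Over.forget _) (isLimitForgetBaseCone K B s₁)

omit [CommRing B] [Algebra K B] in
/-- A finite family of indices has a common refinement (a stage mapping to all of them in the
opposite category). [folklore] -/
theorem exists_hom_of_finite {ι : Type*} [Finite ι] (t : ι → (Idx B s₁)ᵒᵖ) :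
    ∃ t' : (Idx B s₁)ᵒᵖ, ∀ i, Nonempty (t' ⟶ t i) := by
  classical
  haveI := Fintype.ofFinite ι
  refine ⟨op ⟨s₁ ∪ Finset.univ.sup fun i ↦ (t i).unop.1, Finset.subset_union_left⟩,
    fun i ↦ ⟨(homOfLE ?_).op⟩⟩
  change (t i).unop.1 ⊆ s₁ ∪ Finset.univ.sup fun i ↦ (t i).unop.1
  exact (Finset.le_sup (f := fun i ↦ (t i).unop.1) (Finset.mem_univ i)).trans
    Finset.subset_union_right

omit [CommRing B] [Algebra K B] in
/-- Two indices have a common refinement. [folklore] -/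
theorem exists_hom₂ (t t' : (Idx B s₁)ᵒᵖ) : ∃ t'' : (Idx B s₁)ᵒᵖ, Nonempty (t'' ⟶ t) ∧
    Nonempty (t'' ⟶ t') := by
  obtain ⟨t'', h⟩ := exists_hom_of_finite B s₁ (fun b : Bool => bif b then t else t')
  exact ⟨t'', h true, h false⟩

/-- The stages `Spec K[t]` are affine schemes. [folklore] -/
instance isAffine_baseDiagram_obj_left (t : (Idx B s₁)ᵒᵖ) :
    IsAffine ((baseDiagram K B s₁).obj t).left :=
  inferInstanceAs (IsAffine (Spec (CommRingCat.of (sub K B t.unop.1))))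

/-- `Spec B` is an affine scheme. [folklore] -/
instance isAffine_baseCone_pt_left : IsAffine (baseCone K B s₁).pt.left :=
  inferInstanceAs (IsAffine (Spec (CommRingCat.of B)))

/-- The stages `Spec K[t]` are quasi-compact. [folklore] -/
instance compactSpace_baseDiagram_obj_left (t : (Idx B s₁)ᵒᵖ) :
    CompactSpace ((baseDiagram K B s₁).obj t).left :=
  inferInstanceAs (CompactSpace (Spec (CommRingCat.of (sub K B t.unop.1))))

/-- `Spec B` is quasi-compact. [folklore] -/
instance compactSpace_baseCone_pt_left : CompactSpace (baseCone K B s₁).pt.left :=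
  inferInstanceAs (CompactSpace (Spec (CommRingCat.of B)))

/-- The stages `Spec K[t]` are quasi-separated. [folklore] -/
instance quasiSeparatedSpace_baseDiagram_obj_left (t : (Idx B s₁)ᵒᵖ) :
    QuasiSeparatedSpace ((baseDiagram K B s₁).obj t).left :=
  inferInstanceAs (QuasiSeparatedSpace (Spec (CommRingCat.of (sub K B t.unop.1))))

/-- `Spec B` is quasi-separated. [folklore] -/
instance quasiSeparatedSpace_baseCone_pt_left : QuasiSeparatedSpace (baseCone K B s₁).pt.left :=
  inferInstanceAs (QuasiSeparatedSpace (Spec (CommRingCat.of B)))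

/-- The transition maps `Spec K[t'] → Spec K[t]` are affine. [folklore] -/
instance isAffineHom_baseDiagram_map_left {t t' : (Idx B s₁)ᵒᵖ} (f : t ⟶ t') :
    IsAffineHom ((baseDiagram K B s₁).map f).left :=
  isAffineHom_of_isAffine _

/-- The legs `Spec B → Spec K[t]` are affine. [folklore] -/
instance isAffineHom_baseCone_π_app_left (t : (Idx B s₁)ᵒᵖ) :
    IsAffineHom ((baseCone K B s₁).π.app t).left :=
  inferInstanceAs (IsAffineHom (Spec.map ((ringCocone K B s₁).ι.app t.unop)))

/-! ## Base change squares of `P ⊗ -` -/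

section Whisker

variable {K}
variable (P : SchemeOver K) {T T' : SchemeOver K} (g : T' ⟶ T)

/-- **`(P ⊗ T').left → (P ⊗ T).left` is the base change of `T'.left → T.left`** along the
projection `(P ⊗ T).left → T.left`, for any morphism `g : T' → T` of `K`-schemes. [folklore] -/
theorem isPullback_whiskerLeft_left :
    IsPullback (P ◁ g).left (pullback.snd P.hom T'.hom) (pullback.snd P.hom T.hom) g.left := by
  refine IsPullback.of_right ?_ (Over.whiskerLeft_left_snd g) (IsPullback.of_hasPullback P.hom T.hom)
  rw [Over.whiskerLeft_left_fst, Over.w g]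
  exact IsPullback.of_hasPullback P.hom T'.hom

/-- `(P ⊗ T').left → (P ⊗ T).left` is affine if `T' → T` is. [folklore] -/
instance isAffineHom_whiskerLeft_left [IsAffineHom g.left] : IsAffineHom (P ◁ g).left :=
  MorphismProperty.of_isPullback (P := @IsAffineHom) (isPullback_whiskerLeft_left P g).flip
    inferInstance

/-- `(P ⊗ T').left → (P ⊗ T).left` is surjective if `T' → T` is. [folklore] -/
instance surjective_whiskerLeft_left [Surjective g.left] : Surjective (P ◁ g).left :=
  MorphismProperty.of_isPullback (P := @Surjective) (isPullback_whiskerLeft_left P g).flip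
    inferInstance

/-- `(P ⊗ T').left → (P ⊗ T).left` is flat if `T' → T` is. [folklore] -/
instance flat_whiskerLeft_left [Flat g.left] : Flat (P ◁ g).left :=
  MorphismProperty.of_isPullback (P := @Flat) (isPullback_whiskerLeft_left P g).flip
    inferInstance

/-- `(P ⊗ T').left → (P ⊗ T).left` is an open immersion if `T' → T` is. [folklore] -/
instance isOpenImmersion_whiskerLeft_left [IsOpenImmersion g.left] :
    IsOpenImmersion (P ◁ g).left :=
  MorphismProperty.of_isPullback (P := @IsOpenImmersion) (isPullback_whiskerLeft_left P g).flip
    inferInstance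

/-- `(P ⊗ T).left` is quasi-compact for `P → Spec K` quasi-compact and `T.left` quasi-compact.
[folklore] -/
instance compactSpace_tensorObj_left [QuasiCompact P.hom] [CompactSpace T.left] :
    CompactSpace (P ⊗ T).left := by
  change CompactSpace ↑(pullback P.hom T.hom)
  haveI : QuasiCompact (pullback.snd P.hom T.hom) := inferInstance
  exact QuasiCompact.compactSpace_of_compactSpace (pullback.snd P.hom T.hom)

/-- `(P ⊗ T).left` is quasi-separated for `P → Spec K` quasi-separated and `T.left`
quasi-separated. [folklore] -/
instance quasiSeparatedSpace_tensorObj_left [QuasiSeparated P.hom] [QuasiSeparatedSpace T.left] :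
    QuasiSeparatedSpace (P ⊗ T).left := by
  change QuasiSeparatedSpace ↑(pullback P.hom T.hom)
  exact quasiSeparatedSpace_of_quasiSeparated (pullback.snd P.hom T.hom)

end Whisker

/-! ## The diagram `t ↦ (P ⊗ Spec K[t]).left` and its limit `(P ⊗ Spec B).left` -/

variable (P : SchemeOver K)

/-- The cofiltered diagram `t ↦ P ×_K Spec K[t] = (P ⊗ Spec K[t]).left` of schemes
(Görtz–Wedhorn I, (10.13)). [cite: GortzWedhorn2020, (10.13), p. 321] -/
def prodDiagram : (Idx B s₁)ᵒᵖ ⥤ Scheme.{u} :=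
  baseDiagram K B s₁ ⋙ tensorLeft P ⋙ Over.forget _

/-- The cone `(P ⊗ Spec B).left → (P ⊗ Spec K[t]).left`. [folklore] -/
def prodCone : Cone (prodDiagram K B s₁ P) :=
  (tensorLeft P ⋙ Over.forget _).mapCone (baseCone K B s₁)

/-- The objects of `prodDiagram` (by `rfl`). [folklore] -/
theorem prodDiagram_obj (t : (Idx B s₁)ᵒᵖ) :
    (prodDiagram K B s₁ P).obj t = (P ⊗ (baseDiagram K B s₁).obj t).left := rfl

/-- The objects of `prodDiagram` are the fibre products `P ×_K Spec K[t]` (by `rfl`). [folklore] -/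
theorem prodDiagram_obj' (t : (Idx B s₁)ᵒᵖ) :
    (prodDiagram K B s₁ P).obj t =
      pullback P.hom (Spec.map (CommRingCat.ofHom (algebraMap K (sub K B t.unop.1)))) := rfl

/-- The transition maps of `prodDiagram` (by `rfl`). [folklore] -/
theorem prodDiagram_map {t t' : (Idx B s₁)ᵒᵖ} (f : t ⟶ t') :
    (prodDiagram K B s₁ P).map f = (P ◁ (baseDiagram K B s₁).map f).left := rfl

/-- The cone point of `prodCone` (by `rfl`). [folklore] -/
theorem prodCone_pt : (prodCone K B s₁ P).pt = (P ⊗ specOver K B).left := rfl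

/-- The legs of `prodCone` (by `rfl`). [folklore] -/
theorem prodCone_π_app (t : (Idx B s₁)ᵒᵖ) :
    (prodCone K B s₁ P).π.app t = (P ◁ (baseCone K B s₁).π.app t).left := rfl

/-- The transition maps commute with the first projections. [folklore] -/
@[reassoc]
theorem prodDiagram_map_fst {t t' : (Idx B s₁)ᵒᵖ} (f : t ⟶ t') :
    (prodDiagram K B s₁ P).map f ≫ pullback.fst _ _ = pullback.fst _ _ :=
  Over.whiskerLeft_left_fst _

/-- The transition maps commute with the second projections. [folklore] -/
@[reassoc]
theorem prodDiagram_map_snd {t t' : (Idx B s₁)ᵒᵖ} (f : t ⟶ t') :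
    (prodDiagram K B s₁ P).map f ≫ pullback.snd _ _ =
      pullback.snd _ _ ≫ ((baseDiagram K B s₁).map f).left :=
  Over.whiskerLeft_left_snd _

/-- The legs commute with the first projections. [folklore] -/
@[reassoc]
theorem prodCone_π_app_fst (t : (Idx B s₁)ᵒᵖ) :
    (prodCone K B s₁ P).π.app t ≫ pullback.fst _ _ = pullback.fst _ _ :=
  Over.whiskerLeft_left_fst _

/-- The legs commute with the second projections. [folklore] -/
@[reassoc]
theorem prodCone_π_app_snd (t : (Idx B s₁)ᵒᵖ) :
    (prodCone K B s₁ P).π.app t ≫ pullback.snd _ _ =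
      pullback.snd _ _ ≫ ((baseCone K B s₁).π.app t).left :=
  Over.whiskerLeft_left_snd _

/-- The transition maps are affine. [folklore] -/
instance isAffineHom_prodDiagram_map {t t' : (Idx B s₁)ᵒᵖ} (f : t ⟶ t') :
    IsAffineHom ((prodDiagram K B s₁ P).map f) := by
  rw [prodDiagram_map]
  infer_instance

/-- The legs are affine. [folklore] -/
instance isAffineHom_prodCone_π_app (t : (Idx B s₁)ᵒᵖ) :
    IsAffineHom ((prodCone K B s₁ P).π.app t) := by
  rw [prodCone_π_app]
  infer_instance

/-- For `P` quasi-compact over `K`, the objects are quasi-compact. [folklore] -/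
instance compactSpace_prodDiagram_obj [QuasiCompact P.hom] (t : (Idx B s₁)ᵒᵖ) :
    CompactSpace ((prodDiagram K B s₁ P).obj t) := by
  rw [prodDiagram_obj]
  infer_instance

/-- For `P` quasi-separated over `K`, the objects are quasi-separated. [folklore] -/
instance quasiSeparatedSpace_prodDiagram_obj [QuasiSeparated P.hom] (t : (Idx B s₁)ᵒᵖ) :
    QuasiSeparatedSpace ((prodDiagram K B s₁ P).obj t) := by
  rw [prodDiagram_obj]
  infer_instance

/-- For `P` quasi-compact over `K`, the cone point is quasi-compact. [folklore] -/
instance compactSpace_prodCone_pt [QuasiCompact P.hom] : CompactSpace (prodCone K B s₁ P).pt :=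
  inferInstanceAs (CompactSpace (P ⊗ (baseCone K B s₁).pt).left)

/-- For `P` quasi-separated over `K`, the cone point is quasi-separated. [folklore] -/
instance quasiSeparatedSpace_prodCone_pt [QuasiSeparated P.hom] :
    QuasiSeparatedSpace (prodCone K B s₁ P).pt :=
  inferInstanceAs (QuasiSeparatedSpace (P ⊗ (baseCone K B s₁).pt).left)

/-! ### `prodCone` is a limit cone -/

variable {K B s₁ P}

/-- All legs of a cone over `prodDiagram` have the same first component. [folklore] -/
theorem cone_π_app_fst_eq (s : Cone (prodDiagram K B s₁ P)) (t t' : (Idx B s₁)ᵒᵖ) :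
    s.π.app t ≫ pullback.fst _ _ = s.π.app t' ≫ pullback.fst _ _ := by
  obtain ⟨t'', ⟨f⟩, ⟨f'⟩⟩ := exists_hom₂ B s₁ t t'
  rw [← s.w f, ← s.w f', Category.assoc, Category.assoc, prodDiagram_map_fst,
    prodDiagram_map_fst]

/-- The second components of the legs of a cone over `prodDiagram` form a cone over the
`Spec K[t]`. [folklore] -/
def sndCone (s : Cone (prodDiagram K B s₁ P)) : Cone (baseDiagram K B s₁ ⋙ Over.forget _) where
  pt := s.pt
  π := { app t := s.π.app t ≫ pullback.snd _ _
         naturality t t' f := by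
           change 𝟙 _ ≫ s.π.app t' ≫ pullback.snd _ _ =
             (s.π.app t ≫ pullback.snd _ _) ≫ ((baseDiagram K B s₁).map f).left
           rw [Category.id_comp, ← s.w f, Category.assoc, Category.assoc, prodDiagram_map_snd] }

/-- The induced morphism to `Spec B` is compatible with the legs. [folklore] -/
@[reassoc]
theorem lift_sndCone_π (s : Cone (prodDiagram K B s₁ P)) (t : (Idx B s₁)ᵒᵖ) :
    (isLimitForgetBaseCone K B s₁).lift (sndCone s) ≫ ((baseCone K B s₁).π.app t).left =
      s.π.app t ≫ pullback.snd _ _ :=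
  (isLimitForgetBaseCone K B s₁).fac (sndCone s) t

/-- The (common) first component of the legs of a cone over `prodDiagram`. [folklore] -/
def fstComp (s : Cone (prodDiagram K B s₁ P)) : s.pt ⟶ P.left :=
  s.π.app (op default) ≫ pullback.fst _ _

/-- `fstComp` is the first component of every leg. [folklore] -/
theorem fstComp_eq (s : Cone (prodDiagram K B s₁ P)) (t : (Idx B s₁)ᵒᵖ) :
    fstComp s = s.π.app t ≫ pullback.fst _ _ :=
  cone_π_app_fst_eq s _ _

/-- The two components of a cone over `prodDiagram` agree over `Spec K`. [folklore] -/
theorem fstComp_comp_hom (s : Cone (prodDiagram K B s₁ P)) :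
    fstComp s ≫ P.hom =
      (isLimitForgetBaseCone K B s₁).lift (sndCone s) ≫ (baseCone K B s₁).pt.hom := by
  have h1 : fstComp s ≫ P.hom =
      (s.π.app (op default) ≫ pullback.snd _ _) ≫ ((baseDiagram K B s₁).obj (op default)).hom := by
    rw [fstComp, Category.assoc, pullback.condition, Category.assoc]
  rw [h1, ← lift_sndCone_π, Category.assoc]
  change _ ≫ _ ≫ Spec.map ((baseNat K B s₁).app default) =
    _ ≫ Spec.map (CommRingCat.ofHom (algebraMap K B))
  rw [← baseNat_ι K B s₁ default, Spec.map_comp]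
  rfl

/-- The lift of a cone over `prodDiagram` to `(P ⊗ Spec B).left`. [folklore] -/
def prodLift (s : Cone (prodDiagram K B s₁ P)) : s.pt ⟶ (prodCone K B s₁ P).pt :=
  pullback.lift (fstComp s) ((isLimitForgetBaseCone K B s₁).lift (sndCone s)) (fstComp_comp_hom s)

variable (K B s₁ P) in
/-- **`(P ⊗ Spec B).left` is the limit of the `(P ⊗ Spec K[t]).left`** (fibre products commute
with cofiltered limits; Görtz–Wedhorn I, (10.13): "`X ×_{S₀} S` is the limit of the
`X ×_{S₀} S_λ`"). [cite: GortzWedhorn2020, (10.13), p. 321] -/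
def isLimitProdCone : IsLimit (prodCone K B s₁ P) where
  lift s := prodLift s
  fac s t := by
    apply pullback.hom_ext
    · rw [Category.assoc, prodCone_π_app_fst, prodLift, pullback.lift_fst]
      exact fstComp_eq s t
    · rw [Category.assoc, prodCone_π_app_snd, prodLift, pullback.lift_snd_assoc]
      exact lift_sndCone_π s t
  uniq s m hm := by
    apply pullback.hom_ext
    · rw [prodLift, pullback.lift_fst, fstComp_eq s (op default), ← hm (op default), Category.assoc,
        prodCone_π_app_fst]
    · rw [prodLift, pullback.lift_snd]
      refine (isLimitForgetBaseCone K B s₁).uniq (sndCone s) _ fun t => ?_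
      change (m ≫ pullback.snd _ _) ≫ ((baseCone K B s₁).π.app t).left = s.π.app t ≫ pullback.snd _ _
      rw [Category.assoc, ← prodCone_π_app_snd, ← Category.assoc, hm t]

/-! ## Integrality and noetherianity of the stages (for `B` a domain over a field) -/

section Domain

variable (K B s₁)

/-- For `B` a domain, the stages `Spec K[t]` are integral schemes. [folklore] -/
instance isIntegral_baseDiagram_obj_left [IsDomain B] (t : (Idx B s₁)ᵒᵖ) :
    IsIntegral ((baseDiagram K B s₁).obj t).left := by
  change IsIntegral (Spec (CommRingCat.of (sub K B t.unop.1)))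
  infer_instance

/-- For `B` a domain, `Spec B` is an integral scheme. [folklore] -/
instance isIntegral_baseCone_pt_left [IsDomain B] : IsIntegral (baseCone K B s₁).pt.left := by
  change IsIntegral (Spec (CommRingCat.of B))
  infer_instance

/-- For `B` a domain, the legs `Spec B → Spec K[t]` are dominant (`K[t] ⊆ B`). [folklore] -/
instance isDominant_baseCone_π_app_left [IsDomain B] (t : (Idx B s₁)ᵒᵖ) :
    IsDominant ((baseCone K B s₁).π.app t).left := by
  rw [baseCone_π_app_left]
  refine ⟨(PrimeSpectrum.denseRange_comap_iff_ker_le_nilRadical _).2 ?_⟩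
  intro x hx
  have : ((sub K B t.unop.1).val.toRingHom) x = 0 := hx
  have hx0 : x = 0 := Subtype.ext this
  rw [hx0]
  exact zero_mem _

/-- For `B` a domain, the transition maps `Spec K[t'] → Spec K[t]` are dominant. [folklore] -/
instance isDominant_baseDiagram_map_left [IsDomain B] {t t' : (Idx B s₁)ᵒᵖ} (f : t ⟶ t') :
    IsDominant ((baseDiagram K B s₁).map f).left := by
  rw [baseDiagram_map_left]
  refine ⟨(PrimeSpectrum.denseRange_comap_iff_ker_le_nilRadical _).2 ?_⟩
  intro x hx
  have : (Subalgebra.inclusion (sub_mono (K := K) f.unop.le)) x = 0 := hx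
  have hx0 : x = 0 :=
    (injective_iff_map_eq_zero _).1 (Subalgebra.inclusion_injective _) x this
  rw [hx0]
  exact zero_mem _

variable {K' : Type u} [Field K'] (B' : Type u) [CommRing B'] [Algebra K' B'] (s₁' : Finset B')

/-- Over a field `K`, the stages `Spec K[t]` are locally noetherian schemes (`K[t]` is a finitely
generated `K`-algebra). [folklore] -/
instance isLocallyNoetherian_baseDiagram_obj_left (t : (Idx B' s₁')ᵒᵖ) :
    IsLocallyNoetherian ((baseDiagram K' B' s₁').obj t).left := by
  haveI : IsNoetherianRing (sub K' B' t.unop.1) :=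
    Algebra.FiniteType.isNoetherianRing K' (sub K' B' t.unop.1)
  change IsLocallyNoetherian (Spec (CommRingCat.of (sub K' B' t.unop.1)))
  infer_instance

/-- Over a field `K`, the stages `Spec K[t] → Spec K` are of finite type. [folklore] -/
instance locallyOfFiniteType_baseDiagram_obj_hom (t : (Idx B' s₁')ᵒᵖ) :
    LocallyOfFiniteType ((baseDiagram K' B' s₁').obj t).hom := by
  change LocallyOfFiniteType (Spec.map (CommRingCat.ofHom (algebraMap K' (sub K' B' t.unop.1))))
  rw [HasRingHomProperty.Spec_iff (P := @LocallyOfFiniteType)]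
  exact RingHom.finiteType_algebraMap.mpr inferInstance

end Domain

end SubalgApprox

end Literature.AlgebraicGeometry.Limits

end
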